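import Literature.NumberTheory.LFunctions.LogFreeDensityTheorem14
import HarnessLib

/-!
# The sieve side of Bombieri's Théorème 14 for general weights

Topic `Literature/NumberTheory/LFunctions`, sub-namespace `LogFreeDensity`. Everything here is
PROVED: the `w`-weighted versions (coefficients `b_n = w(n) χ(n) n^{-1-iv}` on the sifted range,
`LogFreeDensity.coefSiftedW`, `|w| ≤ Λ`) of the sieve-side infrastructure of
`LogFreeDensityTheorem14.lean` — the expansion of the summatory function as a character sum, the
hybrid large sieve bound `sieveSideW` (`≤ (C_H/log(z/Q₁)) ∑ w(n)²/n`), measurability and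
integrability of the mean value `meanValueW w χ x z v = ∫ ‖S(t)‖² dt/t`, and Fubini. These serve the
Deuring–Heilbronn case of Théorème 14, where `w = Λ(1 + χ₁ n^{-δ₁})/2` (Bombieri, *Le grand crible*,
§6, Lemme C).

## References
* [Bombieri1987GrandCrible] §6 Théorème 14, Lemme C, pp. 48–52.
-/

noncomputable section

open Complex Finset Filter Real MeasureTheory
open scoped LSeries.notation ArithmeticFunction.vonMangoldt Topology Nat FourierTransform

namespace Literature.NumberTheory.LFunctions.LogFreeDensity

open Literature.NumberTheory.LFunctions Literature.NumberTheory.Sieve.LargeSieve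

/-- The summatory function of the sifted sequence is the character sum of the sieve:
`S_{χ,v}(t) = ∑_{n ∈ G, n ≤ t} (Λ(n)/n) χ(n) e(−ν_n v)`. [folklore] -/
theorem summatory_coefSiftedW_eq (w : ℕ → ℝ) {q : ℕ} (χ : DirichletCharacter ℂ q) (v x : ℝ) (z : ℕ) (t : ℝ) :
    summatory (coefSiftedW w χ v x z) t =
      ∑ n ∈ (siftedSet x z).filter (fun n => n ≤ ⌊t⌋₊),
        ((w n / n : ℝ) : ℂ) * χ n * (𝐞 (logFreq n * (-v)) : ℂ) := by
  classical
  unfold summatory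
  have h1 : ∀ i ∈ Icc 0 ⌊t⌋₊, coefSiftedW w χ v x z i =
      if i ∈ siftedSet x z then ((w i / i : ℝ) : ℂ) * χ i * (𝐞 (logFreq i * (-v)) : ℂ) else 0 := by
    intro i _
    rw [coefSiftedW, ← siftedSet]
    split_ifs with h
    · have hi : i ≠ 0 := by have := (siftedSet_prop h).1; omega
      rw [coefW, natCast_cpow_neg_one_add_eq hi]
      push_cast
      ring
    · rfl
  rw [sum_congr rfl h1, ← sum_filter]
  congr 1
  ext n
  simp only [mem_filter, mem_Icc, Nat.zero_le, true_and]
  tauto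

open scoped Classical in
/-- **The sieve side of Théorème 14** (Bombieri p. 50: "la dernière inégalité résultant du
Théorème 11"): for `1 ≤ Q₁ < z`, `T' ≥ 1`, and `z² T' ≤ ⌊x^{a₀}⌋ + 1`, for every `t`,
`∑_{q ≤ Q₁} ∑*_χ ∫_{−T'}^{T'} ‖S_{χ,v}(t)‖² dv ≤ (C_H/log(z/Q₁)) ∑_{n ∈ G, n ≤ t} Λ(n)²/n`,
`C_H = π²(πe^π/2 + 2)`. [cite: Bombieri1987GrandCrible, §6 Théorème 14 (proof)] -/
theorem sieveSideW (w : ℕ → ℝ) {Q₁ z : ℕ} (hQ₁ : 1 ≤ Q₁) (hz : Q₁ < z) {T' : ℝ} (hT : 1 ≤ T') {x : ℝ}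
    (hzx : (z : ℝ) ^ 2 * T' ≤ ⌊x ^ expoB⌋₊ + 1) (t : ℝ) :
    ∑ q ∈ Icc 1 Q₁, ∑ χ : DirichletCharacter ℂ q with χ.IsPrimitive,
        ∫ v in (-T')..T', ‖summatory (coefSiftedW w χ v x z) t‖ ^ 2 ≤
      (π ^ 2 * (π * Real.exp π / 2 + 2)) / Real.log ((z : ℝ) / Q₁) *
        ∑ n ∈ (siftedSet x z).filter (fun n => n ≤ ⌊t⌋₊), w n ^ 2 / n := by
  set G := (siftedSet x z).filter (fun n => n ≤ ⌊t⌋₊) with hG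
  have hS : ∀ n ∈ G, (∀ m ∈ Icc 1 z, Nat.Coprime n m) ∧ (z : ℝ) ^ 2 * T' ≤ n := by
    intro n hn
    rw [hG, mem_filter] at hn
    obtain ⟨h1, -, h3⟩ := siftedSet_prop hn.1
    refine ⟨h3, hzx.trans ?_⟩
    exact_mod_cast h1
  have h := hybridSieve_sifted hQ₁ hz hT G hS (fun n => ((w n / n : ℝ) : ℂ))
  -- rewrite our left side into the sieve's (substituting `v ↦ −v`)
  have hlhs : ∀ (q : ℕ) (χ : DirichletCharacter ℂ q),
      ∫ v in (-T')..T', ‖summatory (coefSiftedW w χ v x z) t‖ ^ 2 =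
        ∫ v in (-T')..T', ‖∑ n ∈ G, ((w n / n : ℝ) : ℂ) * χ n * (𝐞 (logFreq n * v) : ℂ)‖ ^ 2 := by
    intro q χ
    have h1 := intervalIntegral.integral_comp_neg (a := -T') (b := T')
      (f := fun u : ℝ => ‖∑ n ∈ G, ((w n / n : ℝ) : ℂ) * χ n * (𝐞 (logFreq n * u) : ℂ)‖ ^ 2)
    rw [neg_neg] at h1
    rw [← h1]
    refine intervalIntegral.integral_congr fun v _ => ?_
    show ‖summatory (coefSiftedW w χ v x z) t‖ ^ 2 = ‖∑ n ∈ G, ((w n / n : ℝ) : ℂ) * χ n * (𝐞 (logFreq n * (-v)) : ℂ)‖ ^ 2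
    rw [summatory_coefSiftedW_eq, ← hG]
  simp only [hlhs]
  refine h.trans (le_of_eq ?_)
  congr 1
  refine sum_congr rfl fun n hn => ?_
  have hn0 : (0 : ℝ) < n := by
    have := (siftedSet_prop (mem_filter.1 hn).1).1
    exact_mod_cast (show 0 < n by omega)
  rw [Complex.norm_real, Real.norm_eq_abs, sq_abs]
  field_simp

/-! ### Measurability and integrability of the weighted mean values -/

/-- `v ↦ b_n(v) = coefSiftedW w χ v x z n` is continuous. [folklore] -/
theorem continuous_coefSiftedW (w : ℕ → ℝ) {q : ℕ} (χ : DirichletCharacter ℂ q) (x : ℝ) (z n : ℕ) :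
    Continuous fun v : ℝ => coefSiftedW w χ v x z n := by
  by_cases h : n ∈ (Ioc ⌊x ^ expoB⌋₊ ⌊x⌋₊).filter (fun n => IsPrimePow n ∧ z < n.minFac)
  · have hn : n ≠ 0 := by
      rw [← siftedSet] at h; have := (siftedSet_prop h).1; omega
    have heq : (fun v : ℝ => coefSiftedW w χ v x z n) =
        fun v : ℝ => (w n : ℂ) * χ n * ((n : ℂ)⁻¹ * (𝐞 (logFreq n * (-v)) : ℂ)) := by
      funext v
      rw [coefSiftedW, if_pos h, coefW, natCast_cpow_neg_one_add_eq hn]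
    rw [heq]
    refine continuous_const.mul (continuous_const.mul ?_)
    exact continuous_subtype_val.comp (Real.continuous_fourierChar.comp (continuous_const.mul continuous_neg))
  · have heq : (fun v : ℝ => coefSiftedW w χ v x z n) = fun _ => 0 := by
      funext v; rw [coefSiftedW, if_neg h]
    rw [heq]; exact continuous_const

/-- The two-variable integrand `F(v, t) = ‖S_{χ,v}(t)‖²/t` is measurable. [folklore] -/
theorem measurable_normSq_summatoryW (w : ℕ → ℝ) {q : ℕ} (χ : DirichletCharacter ℂ q) (x : ℝ) (z : ℕ) :
    Measurable fun p : ℝ × ℝ => ‖summatory (coefSiftedW w χ p.1 x z) p.2‖ ^ 2 / p.2 := by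
  -- `H(v, m) = ∑_{i ≤ m} b_i(v)` is measurable on `ℝ × ℕ`
  have hH : Measurable fun p : ℝ × ℕ => ∑ i ∈ Icc 0 p.2, coefSiftedW w χ p.1 x z i := by
    refine measurable_from_prod_countable_left fun m => ?_
    show Measurable fun v : ℝ => ∑ i ∈ Icc 0 m, coefSiftedW w χ v x z i
    exact (continuous_finsetSum _ fun i _ => continuous_coefSiftedW w χ x z i).measurable
  have hfl : Measurable fun p : ℝ × ℝ => (p.1, ⌊p.2⌋₊) :=
    measurable_fst.prodMk (Nat.measurable_floor.comp measurable_snd)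
  have hS : Measurable fun p : ℝ × ℝ => summatory (coefSiftedW w χ p.1 x z) p.2 := by
    have : (fun p : ℝ × ℝ => summatory (coefSiftedW w χ p.1 x z) p.2) =
        (fun p : ℝ × ℕ => ∑ i ∈ Icc 0 p.2, coefSiftedW w χ p.1 x z i) ∘ fun p : ℝ × ℝ => (p.1, ⌊p.2⌋₊) := by
      funext p; rfl
    rw [this]; exact hH.comp hfl
  exact (hS.norm.pow_const 2).div measurable_snd

/-- Uniform bound: `‖S_{χ,v}(t)‖²/t ≤ (∑_{i ≤ ⌊x⌋} Λ(i)/i)²` for `t ≥ 1`. [folklore] -/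
theorem normSq_summatoryW_div_le {w : ℕ → ℝ} (hw : ∀ n, |w n| ≤ Λ n) {q : ℕ} (χ : DirichletCharacter ℂ q) (v x : ℝ) (z : ℕ) {t : ℝ}
    (ht : 1 ≤ t) (htx : t ≤ x) :
    ‖summatory (coefSiftedW w χ v x z) t‖ ^ 2 / t ≤ (∑ i ∈ Icc 0 ⌊x⌋₊, Λ i / i) ^ 2 := by
  have hfl : ⌊t⌋₊ ≤ ⌊x⌋₊ := Nat.floor_le_floor htx
  have h1 : ‖summatory (coefSiftedW w χ v x z) t‖ ≤ ∑ i ∈ Icc 0 ⌊x⌋₊, Λ i / i :=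
    (norm_summatory_le _ hfl).trans (sum_le_sum fun i _ => norm_coefSiftedW_le hw χ v x z i)
  calc ‖summatory (coefSiftedW w χ v x z) t‖ ^ 2 / t ≤ ‖summatory (coefSiftedW w χ v x z) t‖ ^ 2 :=
        div_le_self (by positivity) ht
    _ ≤ _ := pow_le_pow_left₀ (norm_nonneg _) h1 2

/-- The mean value `I_χ(v) = ∫_{(⌊x^{a₀}⌋, x]} ‖S_{χ,v}(t)‖²/t dt`. [cite: Bombieri1987GrandCrible, §6 Lemme B] -/
def meanValueW (w : ℕ → ℝ) {q : ℕ} (χ : DirichletCharacter ℂ q) (x : ℝ) (z : ℕ) (v : ℝ) : ℝ :=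
  ∫ t in Set.Ioc (⌊x ^ expoB⌋₊ : ℝ) x, ‖summatory (coefSiftedW w χ v x z) t‖ ^ 2 / t

/-- `I_χ(v) ≥ 0`. [folklore] -/
theorem meanValueW_nonneg (w : ℕ → ℝ) {q : ℕ} (χ : DirichletCharacter ℂ q) (x : ℝ) (z : ℕ) (v : ℝ) :
    0 ≤ meanValueW w χ x z v :=
  setIntegral_nonneg measurableSet_Ioc fun t ht => by
    have : (0 : ℝ) ≤ t := le_trans (Nat.cast_nonneg _) ht.1.le
    positivity

/-- `I_χ(v) ≤ (∑_{i ≤ x} Λ(i)/i)² · x` (a crude uniform bound). [folklore] -/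
theorem meanValueW_le {w : ℕ → ℝ} (hw : ∀ n, |w n| ≤ Λ n) {q : ℕ} (χ : DirichletCharacter ℂ q) {x : ℝ} (hx : 1 ≤ x) (z : ℕ) (v : ℝ)
    (hNX : 1 ≤ ⌊x ^ expoB⌋₊) :
    meanValueW w χ x z v ≤ (∑ i ∈ Icc 0 ⌊x⌋₊, Λ i / i) ^ 2 * x := by
  unfold meanValueW
  have hvol : volume (Set.Ioc (⌊x ^ expoB⌋₊ : ℝ) x) < ⊤ := measure_Ioc_lt_top
  calc ∫ t in Set.Ioc (⌊x ^ expoB⌋₊ : ℝ) x, ‖summatory (coefSiftedW w χ v x z) t‖ ^ 2 / t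
      ≤ ∫ t in Set.Ioc (⌊x ^ expoB⌋₊ : ℝ) x, (∑ i ∈ Icc 0 ⌊x⌋₊, Λ i / i) ^ 2 := by
        refine setIntegral_mono_on ?_ (integrableOn_const hvol.ne) measurableSet_Ioc fun t ht => ?_
        · exact integrableOn_normSq_summatory_div _ x hNX
        · exact normSq_summatoryW_div_le hw χ v x z (le_trans (by exact_mod_cast hNX) ht.1.le) ht.2
    _ = (∑ i ∈ Icc 0 ⌊x⌋₊, Λ i / i) ^ 2 * (x - ⌊x ^ expoB⌋₊) := by
        have hle : (⌊x ^ expoB⌋₊ : ℝ) ≤ x :=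
          (Nat.floor_le (by positivity)).trans (Real.rpow_le_self_of_one_le hx (by
            linarith [expoB_le_half]))
        rw [setIntegral_const, smul_eq_mul, mul_comm, Measure.real, Real.volume_Ioc,
          ENNReal.toReal_ofReal (by linarith)]
    _ ≤ (∑ i ∈ Icc 0 ⌊x⌋₊, Λ i / i) ^ 2 * x := by
        refine mul_le_mul_of_nonneg_left (by linarith [(Nat.cast_nonneg ⌊x ^ expoB⌋₊ : (0:ℝ) ≤ _)]) (by positivity)

/-- `v ↦ I_χ(v)` is measurable (Fubini). [folklore] -/
theorem measurable_meanValueW (w : ℕ → ℝ) {q : ℕ} (χ : DirichletCharacter ℂ q) (x : ℝ) (z : ℕ) :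
    Measurable (meanValueW w χ x z) := by
  unfold meanValueW
  have h := (measurable_normSq_summatoryW w χ x z).stronglyMeasurable.integral_prod_right'
    (ν := volume.restrict (Set.Ioc (⌊x ^ expoB⌋₊ : ℝ) x))
  exact h.measurable

/-- `I_χ` is integrable on every bounded interval. [folklore] -/
theorem integrableOn_meanValueW {w : ℕ → ℝ} (hw : ∀ n, |w n| ≤ Λ n) {q : ℕ} (χ : DirichletCharacter ℂ q) {x : ℝ} (hx : 1 ≤ x) (z : ℕ)
    (hNX : 1 ≤ ⌊x ^ expoB⌋₊) (a b : ℝ) :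
    IntegrableOn (meanValueW w χ x z) (Set.Icc a b) := by
  refine Measure.integrableOn_of_bounded (M := (∑ i ∈ Icc 0 ⌊x⌋₊, Λ i / i) ^ 2 * x)
    measure_Icc_lt_top.ne (measurable_meanValueW w χ x z).aestronglyMeasurable ?_
  refine Eventually.of_forall fun v => ?_
  rw [Real.norm_eq_abs, abs_of_nonneg (meanValueW_nonneg w χ x z v)]
  exact meanValueW_le hw χ hx z v hNX

/-! ### Fubini: from `∫_v I_χ(v) dv` to `∫_t (∫_v ‖S‖²)/t dt` -/

/-- The integrand `(v, t) ↦ ‖S_{χ,v}(t)‖²/t` is integrable on `(−T', T'] × (⌊x^{a₀}⌋, x]`. [folklore] -/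
theorem integrable_normSq_prodW {w : ℕ → ℝ} (hw : ∀ n, |w n| ≤ Λ n) {q : ℕ} (χ : DirichletCharacter ℂ q) (x : ℝ) (z : ℕ)
    (hNX : 1 ≤ ⌊x ^ expoB⌋₊) (T' : ℝ) :
    Integrable (Function.uncurry fun v t : ℝ => ‖summatory (coefSiftedW w χ v x z) t‖ ^ 2 / t)
      ((volume.restrict (Set.Ioc (-T') T')).prod (volume.restrict (Set.Ioc (⌊x ^ expoB⌋₊ : ℝ) x))) := by
  set Sv : Set ℝ := Set.Ioc (-T') T' with hSv
  set St : Set ℝ := Set.Ioc (⌊x ^ expoB⌋₊ : ℝ) x with hSt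
  set F : ℝ → ℝ → ℝ := fun v t => ‖summatory (coefSiftedW w χ v x z) t‖ ^ 2 / t with hF
  have hmeas : Measurable (Function.uncurry F) := measurable_normSq_summatoryW w χ x z
  have hbound : ∀ p ∈ Sv ×ˢ St, ‖Function.uncurry F p‖ ≤ (∑ i ∈ Icc 0 ⌊x⌋₊, Λ i / i) ^ 2 := by
    rintro ⟨v, t⟩ ⟨-, ht⟩
    rw [hSt] at ht
    have ht1 : (1 : ℝ) ≤ t := le_trans (by exact_mod_cast hNX) ht.1.le
    rw [Function.uncurry_apply_pair, Real.norm_eq_abs, abs_of_nonneg (by rw [hF]; positivity)]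
    exact normSq_summatoryW_div_le hw χ v x z ht1 ht.2
  rw [Measure.prod_restrict, ← Measure.volume_eq_prod]
  refine Measure.integrableOn_of_bounded (M := (∑ i ∈ Icc 0 ⌊x⌋₊, Λ i / i) ^ 2) ?_
    hmeas.aestronglyMeasurable ?_
  · rw [Measure.volume_eq_prod, Measure.prod_prod]
    exact ENNReal.mul_ne_top measure_Ioc_lt_top.ne measure_Ioc_lt_top.ne
  · rw [ae_restrict_iff' (measurableSet_Ioc.prod measurableSet_Ioc)]
    exact Eventually.of_forall hbound

/-- **Interchange of the `v`- and `t`-integrals.** [folklore] -/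
theorem integral_meanValueW_eq {w : ℕ → ℝ} (hw : ∀ n, |w n| ≤ Λ n) {q : ℕ} (χ : DirichletCharacter ℂ q) (x : ℝ) (z : ℕ)
    (hNX : 1 ≤ ⌊x ^ expoB⌋₊) {T' : ℝ} (hT' : 0 ≤ T') :
    ∫ v in (-T')..T', meanValueW w χ x z v =
      ∫ t in Set.Ioc (⌊x ^ expoB⌋₊ : ℝ) x,
        (∫ v in (-T')..T', ‖summatory (coefSiftedW w χ v x z) t‖ ^ 2) / t := by
  have hswap := integral_integral_swap (integrable_normSq_prodW hw χ x z hNX T')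
  rw [intervalIntegral.integral_of_le (by linarith)]
  unfold meanValueW
  rw [show (∫ v in Set.Ioc (-T') T', ∫ t in Set.Ioc (⌊x ^ expoB⌋₊ : ℝ) x,
      ‖summatory (coefSiftedW w χ v x z) t‖ ^ 2 / t) =
      ∫ v in Set.Ioc (-T') T', ∫ t in Set.Ioc (⌊x ^ expoB⌋₊ : ℝ) x,
        (fun v t : ℝ => ‖summatory (coefSiftedW w χ v x z) t‖ ^ 2 / t) v t from rfl, hswap]
  refine setIntegral_congr_fun measurableSet_Ioc fun t _ => ?_
  rw [intervalIntegral.integral_of_le (by linarith), ← integral_div]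

/-- The inner `v`-integral divided by `t` is integrable in `t`. [folklore] -/
theorem integrableOn_innerW {w : ℕ → ℝ} (hw : ∀ n, |w n| ≤ Λ n) {q : ℕ} (χ : DirichletCharacter ℂ q) (x : ℝ) (z : ℕ)
    (hNX : 1 ≤ ⌊x ^ expoB⌋₊) {T' : ℝ} (hT' : 0 ≤ T') :
    IntegrableOn (fun t => (∫ v in (-T')..T', ‖summatory (coefSiftedW w χ v x z) t‖ ^ 2) / t)
      (Set.Ioc (⌊x ^ expoB⌋₊ : ℝ) x) := by
  have h := (integrable_normSq_prodW hw χ x z hNX T').integral_prod_right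
  refine (h.congr (Eventually.of_forall fun t => ?_))
  simp only [Function.uncurry_apply_pair]
  rw [intervalIntegral.integral_of_le (by linarith), ← integral_div]

end Literature.NumberTheory.LFunctions.LogFreeDensity
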